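import Summits.QuantumFields.BalabanUV.Beta.FP.PerfectLegSwapReflection
import Summits.QuantumFields.BalabanUV.Beta.FP.SliceKcovChartAssembly
import Summits.QuantumFields.BalabanUV.Beta.FP.KernelReflectionBoundedContact2
import Summits.QuantumFields.BalabanUV.Beta.FP.SliceContactLetters

/-!
# `BalabanUV.Beta.FP.SliceKcovStraight` — road «FP», binder row D1, sub-row **H2-ASM-5a (Kcov)**, module R13: THE (Kcov) LETTER OF THE GLUON SECTOR IN THE
# «STRAIGHT» READING, BY TYPE — a `Loc`-currency R5′ socket at a bounded leg, the chart-law END at a bounded leg (R6 inside), and the instance at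
# `(Pkerˢˢ, MFˢˢ, idF)` for the TOTAL data `(S₃ + sliceA, S₄ + sliceW)` from the DISPLAYED laws `hS₃`∕`hS₄` of R10

HONEST DEPENDENCY (page 1, mandatory): continuum YM on T⁴ ⇐ BetaPertH ∧ nine spine estimates (0/9 proved); BetaPertH ⇐ (D1) ∧ (D4) ∧ CAP+tail;
G-an2-4 gates asym, D1 and NE2/3/4.  HONEST FRAMING (cell contract, verbatim): «discharging `BetaPertH` makes Bałaban's UV stability UNCONDITIONAL —
a real constructive-QFT result; it is NOT the continuum limit and NOT the Clay problem.»  THIS MODULE DISCHARGES NOTHING of the wall: [folklore] kernel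
bookkeeping (absolutely convergent lattice traces at a BOUNDED leg against LOCALISED vertices) composing R5′ (`KernelReflectionBoundedContact2`), R6
(`ChartConjugationBounded.consistency_contact₂_of_conj`), R7∕R8∕R10 (the slice laws in chart form), R9∕R12 (the swapped pair) BY NAME; the laws `hS₃`∕`hS₄` of the
`S∞`-share, its localisation, its unit-lattice covariance and the remainder's letters are DISPLAYED HYPOTHESES, asserted for no object of Bałaban's.  0 def,
0 `def … : Prop`, nothing cited, 0 sorry; 0 estimates; 0∕4 row-D1 binders; NOT the (Kcov) letter of `PiBF` AS TYPED (leg `Pker`; see R12's N-d1leaf02g11-1),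
NOT H2V-4, NOT (ASYMP), NOT D1, NOT BetaPertH, NOT continuum, NOT Clay.

ABSOLUTE RULE (cell charter, verbatim): «No internally-minted statement may enter as a cited fact. Every hypothesis is either kernel-proved in this package or a
verbatim quotation of a PUBLISHED theorem with page reference. The manuscript(s) under audit are NOT citable for their own disputed steps — they are the thing
under adjudication; programme-internal (2001/route/tribunal) claims are never citable.»

CONTENT.
* §1 [folklore] R5′ IN `Loc` CURRENCY: `bubble_refK_loc_bdd`, `tadpole_refK_loc_bdd`, `hess_refl_loc_contact₂`, `hessKer_refl_loc_contact₂`,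
  **`axisReflectionCovariant_flip_hessKer_loc_contact₂`** — `KernelReflectionBoundedContact2` §2–§4 with every `VertexFamily`∕`VertexFamily₂` letter replaced by
  `TameKernelCalculus.Loc` of each member (what the bounded-leg bricks of `ChartConjugationBoundedBricks` actually consume).
* §2 [folklore] **`axisReflectionCovariant_flip_hessKer_chart_bdd`** — THE CHART-LAW END AT A BOUNDED LEG: bounded translation-invariant leg `A`, spread form `𝕄` and
  unit `E` with the four relative rules, localised block-covariant data `(V, W)`, and per axis a leg map fixing `A`, an offset, localised diagonal-free data
  `X`, `X₂` (the first commuting with `E`), a localised TADPOLE-NULL remainder `Rm`, and the laws (Sr-conj)∕(Wr-conj-rem) ⟹ `AxisReflectionCovariant (z ↦ hessKer A V W μ ν (−z))`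
  (the `Bdd`-leg twin of an2's `ChartConjugationRemainderEnd.axisReflectionCovariant_flip_hessKer_conj_rem_rel`; the consistency identity is R6, not a hypothesis).
* §3 [our object] **`axisReflectionCovariant_flip_hessKer_sliceTotal_straight`** — THE INSTANCE: leg `Pkerˢˢ`, form `MFˢˢ`, unit `idF` (rules R9 + R12, leg maps `Φ N α` by
  R12 `refK_Φ_PkerSwap`), data `V := S₃ + sliceA 3`, `W := S₄ + sliceW 3` with R10's total laws from the DISPLAYED `hS₃`∕`hS₄`; the slice share's letters are the
  tree's (`locStencil_sliceA`, `biLoc_sliceW`, `sliceA_translate`, `sliceW_translate`, `biLoc_diagK_ctGen`), the `S∞` share's are displayed.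
Provenance: D1 formalisation swarm seat b2b-balaban-beta-d1-formalise-leaf-02 gen 11 (road FP engine lineage), 2026-08-21.
-/

noncomputable section

namespace Summit.QuantumFields.BalabanUV.Beta.FP.SliceKcovStraight

open Finset
open scoped BigOperators
open Literature.MathematicalPhysics.QuantumFieldTheory.Balaban1983to89
open Literature.MathematicalPhysics.QuantumFieldTheory.Balaban1983to89.Beta
open B12Sec2to5 (l1 l1_nonneg)
open B6BondElimination (unitVec unitVec_apply)
open PolarizationSign (axisReflect axisReflect_apply reflSign AxisReflectionCovariant)
open ExpKernelCalculus (MKer Site BiLoc Decays comp tr bubble tadpole hess hessKer shiftK BlockCovariant hess_eq_hessKer)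
open KernelWard (Bdd biLoc_recentre)
open KernelReflection (LegMap refK refK_apply tadpole_smul bubble_smul_left bubble_smul_right bondRefl bondRefl_sub)
open ResolventReflection (bref bref_eq_bondRefl Φ)
open OneStepResolventKernel (Fib LocStencil bound_mono)
open Summit.QuantumFields.BalabanUV.Beta.TameKernelCalculus (Spr Loc)
open Summit.QuantumFields.BalabanUV.Beta.ChartConjugation (conjV conjW loc_conjV loc_conjW)
open Summit.QuantumFields.BalabanUV.Beta.BorderedHessian (diagK diagK_apply ctGen biLoc_diagK_ctGen cCT cCT_nonneg abs_ctGen_le)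
open Summit.QuantumFields.BalabanUV.Beta.FP.KernelReflectionBounded (bubble_refK_bdd tadpole_refK_bdd)
open Summit.QuantumFields.BalabanUV.Beta.FP.ChartConjugationBoundedBricks (tadpole_add_bdd bubble_add_left_bdd bubble_add_right_bdd)
open Summit.QuantumFields.BalabanUV.Beta.FP.ChartConjugationBounded (consistency_contact₂_of_conj)
open Summit.QuantumFields.BalabanUV.Beta.FP.SliceVertex (sliceA sliceA_translate locStencil_sliceA)
open Summit.QuantumFields.BalabanUV.Beta.FP.SliceBiStencil (sliceW sliceW_translate biLoc_sliceW)
open Summit.QuantumFields.BalabanUV.Beta.FP.SliceGaugeLaw (ddKer)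
open Summit.QuantumFields.BalabanUV.Beta.FP.PerfectPolarization (Pker)
open Summit.QuantumFields.BalabanUV.Beta.FP.PerfectPropagatorInverse (MF idF)
open Summit.QuantumFields.BalabanUV.Beta.FP.PerfectPolarizationWard (blockCovariant_one)
open Summit.QuantumFields.BalabanUV.Beta.FP.SliceContactChart (spr_idF comp_idF_diagK_comm)
open Summit.QuantumFields.BalabanUV.Beta.FP.PerfectPairSiteSwap (comp_PkerSwap_MFSwap comp_MFSwap_PkerSwap)
open Summit.QuantumFields.BalabanUV.Beta.FP.SliceKcovChartAssembly (srConj_total wrConj_total)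
open Summit.QuantumFields.BalabanUV.Beta.FP.PerfectLegSwapReflection (refK_Φ_PkerSwap bdd_PkerSwap PkerSwap_translate spr_MFSwap comp_PkerSwap_idF
  comp_idF_PkerSwap)

variable {d : ℕ} {F : Type*} [Fintype F]

/-! ## §1 The R5′ socket in `Loc` currency -/

omit [Fintype F] in
/-- [folklore] a localised kernel is bi-localised at `(0, 0)` at its own positive rate (recentring costs a finite factor). -/
theorem biLoc_zero_of_loc {K : MKer (d + 1) F} (hK : Loc K) : ∃ C δ : ℝ, 0 < δ ∧ 0 ≤ C ∧ BiLoc K 0 0 C δ := by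
  obtain ⟨p, q, C, δ, hδ, h⟩ := hK
  have h0 := biLoc_recentre h hδ.le 0 0
  refine ⟨|C| * Real.exp (δ * (l1 (p - 0) + l1 (q - 0))), δ, hδ, by positivity, fun x y a b => (h0 x y a b).trans ?_⟩
  exact mul_le_mul_of_nonneg_right (mul_le_mul_of_nonneg_right (le_abs_self C) (Real.exp_pos _).le) (Real.exp_pos _).le

omit [Fintype F] in
/-- [folklore] two localised kernels are bi-localised at `(0, 0)` at ONE common positive rate. -/
theorem biLoc_zero_pair_of_loc {K L : MKer (d + 1) F} (hK : Loc K) (hL : Loc L) :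
    ∃ CK CL δ : ℝ, 0 < δ ∧ BiLoc K 0 0 CK δ ∧ BiLoc L 0 0 CL δ := by
  obtain ⟨CK, δK, hδK, hCK, hK'⟩ := biLoc_zero_of_loc hK
  obtain ⟨CL, δL, hδL, hCL, hL'⟩ := biLoc_zero_of_loc hL
  refine ⟨CK, CL, min δK δL, lt_min hδK hδL, fun x y a b => ?_, fun x y a b => ?_⟩
  · exact bound_mono (hK' x y a b) hCK le_rfl (min_le_left _ _) (add_nonneg (l1_nonneg _) (l1_nonneg _))
  · exact bound_mono (hL' x y a b) hCL le_rfl (min_le_right _ _) (add_nonneg (l1_nonneg _) (l1_nonneg _))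

/-- [folklore] **THE BUBBLE IS RELABELLING-INVARIANT, BOUNDED LEG, `Loc` VERTICES** (`KernelReflectionBounded.bubble_refK_bdd`). -/
theorem bubble_refK_loc_bdd (Φ' : LegMap (d + 1) F) {A V W : MKer (d + 1) F} {B : ℝ} (hA : Bdd A B) (hV : Loc V) (hW : Loc W) :
    bubble (refK Φ' A) (refK Φ' V) (refK Φ' W) = bubble A V W := by
  obtain ⟨CV, CW, δ, hδ, hV', hW'⟩ := biLoc_zero_pair_of_loc hV hW
  exact bubble_refK_bdd Φ' hA hV' hW' hδ

/-- [folklore] **THE TADPOLE IS RELABELLING-INVARIANT, BOUNDED LEG, `Loc` TABLE** (`KernelReflectionBounded.tadpole_refK_bdd`). -/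
theorem tadpole_refK_loc_bdd (Φ' : LegMap (d + 1) F) {A W₂ : MKer (d + 1) F} {B : ℝ} (hA : Bdd A B) (hW : Loc W₂) :
    tadpole (refK Φ' A) (refK Φ' W₂) = tadpole A W₂ := by
  obtain ⟨p, q, C, δ, hδ, h⟩ := hW
  exact tadpole_refK_bdd Φ' hA h hδ

/-- [folklore] **COVARIANCE OF THE RESOLVENT HESSIAN, BOUNDED LEG, BOTH LAWS WITH CONTACT, `Loc` LETTERS** (`KernelReflectionBoundedContact2.hess_refl_bdd_contact₂`):
`hess μ (ρ μ y) ν (ρ ν y′) = σ μ σ ν · (hess μ y ν y′ + ½·tadpole A (CtW μ y ν y′) − ½·(bubble A (CtV μ y) (V ν y′) + bubble A (V μ y) (CtV ν y′) + bubble A (CtV μ y) (CtV ν y′)))`. -/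
theorem hess_refl_loc_contact₂ (Φ' : LegMap (d + 1) F) {A : MKer (d + 1) F} {V CtV : Fin (d + 1) → (Fin (d + 1) → ℤ) → MKer (d + 1) F}
    {W CtW : Fin (d + 1) → (Fin (d + 1) → ℤ) → Fin (d + 1) → (Fin (d + 1) → ℤ) → MKer (d + 1) F} {B : ℝ}
    (hA : Bdd A B) (hV : ∀ μ y, Loc (V μ y)) (hCtV : ∀ μ y, Loc (CtV μ y)) (hW : ∀ μ y ν y', Loc (W μ y ν y'))
    (hCtW : ∀ μ y ν y', Loc (CtW μ y ν y')) (hAr : refK Φ' A = A) (ρ : Fin (d + 1) → (Fin (d + 1) → ℤ) → (Fin (d + 1) → ℤ)) (σ : Fin (d + 1) → ℝ)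
    (hVr : ∀ μ y, V μ (ρ μ y) = σ μ • refK Φ' (V μ y + CtV μ y))
    (hWr : ∀ μ y ν y', W μ (ρ μ y) ν (ρ ν y') = (σ μ * σ ν) • refK Φ' (W μ y ν y' + CtW μ y ν y'))
    (μ : Fin (d + 1)) (y : Fin (d + 1) → ℤ) (ν : Fin (d + 1)) (y' : Fin (d + 1) → ℤ) :
    hess A V W μ (ρ μ y) ν (ρ ν y') = σ μ * σ ν * (hess A V W μ y ν y' + (1 / 2) * tadpole A (CtW μ y ν y')
      - (1 / 2) * (bubble A (CtV μ y) (V ν y') + bubble A (V μ y) (CtV ν y') + bubble A (CtV μ y) (CtV ν y'))) := by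
  unfold ExpKernelCalculus.hess
  rw [hWr, hVr, hVr, tadpole_smul, bubble_smul_left, bubble_smul_right]
  conv_lhs => rw [← hAr]
  rw [tadpole_refK_loc_bdd Φ' hA ((hW μ y ν y').add (hCtW μ y ν y')), tadpole_add_bdd hA (hW μ y ν y') (hCtW μ y ν y'),
    bubble_refK_loc_bdd Φ' hA ((hV μ y).add (hCtV μ y)) ((hV ν y').add (hCtV ν y')),
    bubble_add_left_bdd hA (hV μ y) (hCtV μ y) ((hV ν y').add (hCtV ν y')),
    bubble_add_right_bdd hA (hV μ y) (hV ν y') (hCtV ν y'), bubble_add_right_bdd hA (hCtV μ y) (hV ν y') (hCtV ν y')]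
  ring

/-- [folklore] **THE DIFFERENCE-VARIABLE LAW WITH BOTH CONTACTS, `Loc` LETTERS** (`KernelReflectionBoundedContact2.hessKer_refl_bdd_contact₂`). -/
theorem hessKer_refl_loc_contact₂ (Φ' : LegMap (d + 1) F) {A : MKer (d + 1) F} {V CtV : Fin (d + 1) → (Fin (d + 1) → ℤ) → MKer (d + 1) F}
    {W CtW : Fin (d + 1) → (Fin (d + 1) → ℤ) → Fin (d + 1) → (Fin (d + 1) → ℤ) → MKer (d + 1) F} {B : ℝ} {N : ℕ}
    (hA : Bdd A B) (hV : ∀ μ y, Loc (V μ y)) (hCtV : ∀ μ y, Loc (CtV μ y)) (hW : ∀ μ y ν y', Loc (W μ y ν y'))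
    (hCtW : ∀ μ y ν y', Loc (CtW μ y ν y')) (hcov : BlockCovariant A V W N) (hAr : refK Φ' A = A) (α : Fin (d + 1)) (c : ℤ)
    (hVr : ∀ μ y, V μ (bondRefl α c μ y) = reflSign α μ • refK Φ' (V μ y + CtV μ y))
    (hWr : ∀ μ y ν y', W μ (bondRefl α c μ y) ν (bondRefl α c ν y') = (reflSign α μ * reflSign α ν) • refK Φ' (W μ y ν y' + CtW μ y ν y'))
    (μ ν : Fin (d + 1)) (z : Fin (d + 1) → ℤ) :
    hessKer A V W μ ν (axisReflect α z + (if μ = α then unitVec α else 0) - (if ν = α then unitVec α else 0))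
      = reflSign α μ * reflSign α ν * (hessKer A V W μ ν z + (1 / 2) * tadpole A (CtW μ 0 ν z)
          - (1 / 2) * (bubble A (CtV μ 0) (V ν z) + bubble A (V μ 0) (CtV ν z) + bubble A (CtV μ 0) (CtV ν z))) := by
  have h := hess_refl_loc_contact₂ Φ' hA hV hCtV hW hCtW hAr (bondRefl α c) (reflSign α) hVr hWr μ 0 ν z
  rw [hess_eq_hessKer hcov, hess_eq_hessKer hcov, sub_zero, bondRefl_sub, sub_zero] at h
  exact h

/-- [folklore] **`AxisReflectionCovariant (z ↦ hessKer A V W μ ν (−z))` FROM TWO LAWS WITH CONTACT AND ONE CONSISTENCY IDENTITY, `Loc` LETTERS** —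
`KernelReflectionBoundedContact2.axisReflectionCovariant_flip_hessKer_bdd_contact₂` with the uniform `VertexFamily` letters of `V`, `W`, `CtVα`, `CtWα` replaced by `Loc`
of each member. -/
theorem axisReflectionCovariant_flip_hessKer_loc_contact₂ {A : MKer (d + 1) F} {V : Fin (d + 1) → (Fin (d + 1) → ℤ) → MKer (d + 1) F}
    {W : Fin (d + 1) → (Fin (d + 1) → ℤ) → Fin (d + 1) → (Fin (d + 1) → ℤ) → MKer (d + 1) F} {B : ℝ} {N : ℕ}
    (hA : Bdd A B) (hV : ∀ μ y, Loc (V μ y)) (hW : ∀ μ y ν y', Loc (W μ y ν y')) (hcov : BlockCovariant A V W N)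
    (hAr : ∀ α : Fin (d + 1), ∃ Φα : LegMap (d + 1) F, refK Φα A = A ∧ ∃ c : ℤ, ∃ CtVα : Fin (d + 1) → (Fin (d + 1) → ℤ) → MKer (d + 1) F,
      ∃ CtWα : Fin (d + 1) → (Fin (d + 1) → ℤ) → Fin (d + 1) → (Fin (d + 1) → ℤ) → MKer (d + 1) F,
      (∀ μ y, Loc (CtVα μ y)) ∧ (∀ μ y ν y', Loc (CtWα μ y ν y')) ∧
      (∀ μ y, V μ (bondRefl α c μ y) = reflSign α μ • refK Φα (V μ y + CtVα μ y)) ∧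
      (∀ μ y ν y', W μ (bondRefl α c μ y) ν (bondRefl α c ν y') = (reflSign α μ * reflSign α ν) • refK Φα (W μ y ν y' + CtWα μ y ν y')) ∧
      (∀ μ ν z, tadpole A (CtWα μ 0 ν z) =
        bubble A (CtVα μ 0) (V ν z) + bubble A (V μ 0) (CtVα ν z) + bubble A (CtVα μ 0) (CtVα ν z))) :
    AxisReflectionCovariant (fun μ ν z => hessKer A V W μ ν (-z)) := by
  intro α μ ν z
  obtain ⟨Φα, hA', c, CtVα, CtWα, hCtV, hCtW, hVr, hWr, hX⟩ := hAr α
  have h := hessKer_refl_loc_contact₂ Φα hA hV hCtV hW hCtW hcov hA' α c hVr hWr μ ν (-z)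
  rw [hX μ ν (-z)] at h
  have e : -(axisReflect α z - (if μ = α then unitVec α else 0) + (if ν = α then unitVec α else 0))
      = axisReflect α (-z) + (if μ = α then unitVec α else 0) - (if ν = α then unitVec α else 0) := by
    funext i
    simp only [Pi.neg_apply, Pi.sub_apply, Pi.add_apply, axisReflect_apply]
    by_cases hi : i = α <;> by_cases hμ : μ = α <;> by_cases hν : ν = α <;> simp [hi, hμ, hν, unitVec_apply] <;> ring
  show hessKer A V W μ ν (-(axisReflect α z - (if μ = α then unitVec α else 0) + (if ν = α then unitVec α else 0)))
    = reflSign α μ * reflSign α ν * hessKer A V W μ ν (-z)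
  rw [e, h]
  ring

/-! ## §2 The chart-law END at a bounded leg -/

/-- [folklore] **THE CHART-LAW END AT A BOUNDED LEG** (the `Bdd`-leg twin of an2's `ChartConjugationRemainderEnd.axisReflectionCovariant_flip_hessKer_conj_rem_rel`, with R6's
`consistency_contact₂_of_conj` supplying the consistency identity): for a bounded leg `A`, spread `𝕄`, `E` with `A∘𝕄 = E = 𝕄∘A`, `A∘E = A = E∘A`, localised block-covariant
data and, per axis, a leg map fixing `A`, an offset `c`, localised `X` (commuting with `E`), localised `X₂`, a localised tadpole-null `Rm`, and the laws
(Sr-conj) `V μ (ρ μ y) = ε_μ • Φ·(V μ y + conjV 𝕄 (X μ y))`, (Wr-conj-rem) `W … = ε_μ ε_ν • Φ·(W + conjW 𝕄 (V μ y) (V ν y′) (X μ y) (X ν y′) (X₂ …) + Rm …)` ⟹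
`AxisReflectionCovariant (z ↦ hessKer A V W μ ν (−z))`. -/
theorem axisReflectionCovariant_flip_hessKer_chart_bdd {A M E : MKer (d + 1) F} {V : Fin (d + 1) → (Fin (d + 1) → ℤ) → MKer (d + 1) F}
    {W : Fin (d + 1) → (Fin (d + 1) → ℤ) → Fin (d + 1) → (Fin (d + 1) → ℤ) → MKer (d + 1) F} {B : ℝ} {N : ℕ}
    (hA : Bdd A B) (hM : Spr M) (hE : Spr E) (hAM : comp A M = E) (hMA : comp M A = E) (hAE : comp A E = A) (hEA : comp E A = A)
    (hV : ∀ μ y, Loc (V μ y)) (hW : ∀ μ y ν y', Loc (W μ y ν y')) (hcov : BlockCovariant A V W N)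
    (hAr : ∀ α : Fin (d + 1), ∃ Φα : LegMap (d + 1) F, refK Φα A = A ∧ ∃ (c : ℤ) (X : Fin (d + 1) → (Fin (d + 1) → ℤ) → MKer (d + 1) F)
      (X₂ Rm : Fin (d + 1) → (Fin (d + 1) → ℤ) → Fin (d + 1) → (Fin (d + 1) → ℤ) → MKer (d + 1) F),
      (∀ μ y, Loc (X μ y)) ∧ (∀ μ y ν y', Loc (X₂ μ y ν y')) ∧ (∀ μ y, comp E (X μ y) = comp (X μ y) E) ∧
      (∀ μ y ν y', Loc (Rm μ y ν y')) ∧ (∀ μ y ν y', tadpole A (Rm μ y ν y') = 0) ∧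
      (∀ μ y, V μ (bondRefl α c μ y) = reflSign α μ • refK Φα (V μ y + conjV M (X μ y))) ∧
      (∀ μ y ν y', W μ (bondRefl α c μ y) ν (bondRefl α c ν y') =
        (reflSign α μ * reflSign α ν) • refK Φα (W μ y ν y' + conjW M (V μ y) (V ν y') (X μ y) (X ν y') (X₂ μ y ν y') + Rm μ y ν y'))) :
    AxisReflectionCovariant (fun μ ν z => hessKer A V W μ ν (-z)) := by
  refine axisReflectionCovariant_flip_hessKer_loc_contact₂ hA hV hW hcov fun α => ?_
  obtain ⟨Φα, hA', c, X, X₂, Rm, hX, hX₂, hEX, hRmL, hRm0, hVr, hWr⟩ := hAr α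
  refine ⟨Φα, hA', c, fun μ y => conjV M (X μ y), fun μ y ν y' => conjW M (V μ y) (V ν y') (X μ y) (X ν y') (X₂ μ y ν y') + Rm μ y ν y',
    fun μ y => loc_conjV hM (hX μ y), fun μ y ν y' => (loc_conjW hM (hV μ y) (hV ν y') (hX μ y) (hX ν y') (hX₂ μ y ν y')).add (hRmL μ y ν y'),
    hVr, fun μ y ν y' => ?_, ?_⟩
  · rw [hWr μ y ν y', add_assoc]
  · exact consistency_contact₂_of_conj hA hM hE hAM hMA hAE hEA hV hX hX₂ hEX hRmL hRm0

/-! ## §3 The instance: total gluon data at the swapped perfect pair -/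

section Instance

/-- [folklore] a diagonal kernel with a negated symbol is the negative of the diagonal kernel. -/
theorem diagK_neg_symbol (g : Site 4 → Fib 3 → ℝ) : diagK (fun y c => -g y c) = -diagK g := by
  funext x z a b
  rw [Pi.neg_apply, Pi.neg_apply, Pi.neg_apply, Pi.neg_apply, diagK_apply, diagK_apply]
  split_ifs <;> ring

/-- [folklore] the NEGATED product-chart generator is localised at its bond. -/
theorem loc_diagK_neg_ctGen (α : Fin 4) (L : ℕ) [NeZero L] (κ : Fin 4) (u : Site 4) : Loc (diagK (fun y c => -ctGen 3 α L κ u y c)) := by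
  rw [diagK_neg_symbol]
  exact Loc.neg ⟨u, u, cCT 3 L 1, 1, one_pos, biLoc_diagK_ctGen α L κ u zero_le_one⟩

/-- [folklore] the product of two generator symbols is localised at the FIRST bond (the second symbol is bounded by `1 + ℓ(L)`). -/
theorem loc_diagK_ctGen_mul (α : Fin 4) (L : ℕ) [NeZero L] (κ : Fin 4) (u : Site 4) (κ' : Fin 4) (u' : Site 4) :
    Loc (diagK (fun y c => ctGen 3 α L κ u y c * ctGen 3 α L κ' u' y c)) := by
  refine ⟨u, u, cCT 3 L 1 * (1 + (AveragingHessianKernels.ell (3 + 1) L : ℝ)), 1, one_pos, fun x z a b => ?_⟩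
  have h1 := biLoc_diagK_ctGen α L κ u zero_le_one x z a b
  rw [diagK_apply] at h1 ⊢
  split_ifs with h
  · rw [if_pos h] at h1
    have h2 : |ctGen 3 α L κ' u' x a| ≤ 1 + (AveragingHessianKernels.ell (3 + 1) L : ℝ) := abs_ctGen_le α L κ' u' x a
    calc |ctGen 3 α L κ u x a * ctGen 3 α L κ' u' x a| = |ctGen 3 α L κ u x a| * |ctGen 3 α L κ' u' x a| := abs_mul _ _
      _ ≤ (cCT 3 L 1 * Real.exp (-1 * (l1 (x - u) + l1 (z - u)))) * (1 + (AveragingHessianKernels.ell (3 + 1) L : ℝ)) :=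
          mul_le_mul h1 h2 (abs_nonneg _) (mul_nonneg (cCT_nonneg 3 L 1) (Real.exp_pos _).le)
      _ = cCT 3 L 1 * (1 + (AveragingHessianKernels.ell (3 + 1) L : ℝ)) * Real.exp (-1 * (l1 (x - u) + l1 (z - u))) := by ring
  · rw [abs_zero]
    have : (0 : ℝ) ≤ 1 + (AveragingHessianKernels.ell (3 + 1) L : ℝ) := by positivity
    exact mul_nonneg (mul_nonneg (cCT_nonneg 3 L 1) this) (Real.exp_pos _).le

variable (N L : ℕ) [NeZero L] {S₃ : Fin 4 → Site 4 → MKer 4 (Fib 3)} {S₄ : Fin 4 → Site 4 → Fin 4 → Site 4 → MKer 4 (Fib 3)}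
  {Rm : Fin 4 → Fin 4 → Site 4 → Fin 4 → Site 4 → MKer 4 (Fib 3)}

/-- [our object] **THE (Kcov) LETTER OF THE GLUON SECTOR, «STRAIGHT» READING, BY TYPE.**  DISPLAYED: localisation (`hS₃L`, `hS₄L`) and unit-lattice covariance (`hS₃t`,
`hS₄t`) of the `S∞`-share, its laws `hS₃`∕`hS₄` against `MFˢˢ − ddKer` EXACTLY as in R10 (`SliceKcovChartAssembly.srConj_total`∕`wrConj_total`), the remainder's
localisation `hRmL` and tadpole-nullity `hRm0` against the swapped leg.  CONCLUSION: the flipped resolvent Hessian kernel of the TOTAL data `(S₃ + sliceA 3, S₄ + sliceW 3)`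
at the swapped perfect leg `Pkerˢˢ` is single-axis reflection covariant.  INGREDIENTS BY NAME: §2 at `(Pkerˢˢ, MFˢˢ, idF)` (rules R9 `comp_PkerSwap_MFSwap`∕
`comp_MFSwap_PkerSwap`, R12 `comp_PkerSwap_idF`∕`comp_idF_PkerSwap`, `bdd_PkerSwap`, `spr_MFSwap`, `spr_idF`), leg maps `Φ N α` (R12 `refK_Φ_PkerSwap`), offset `c = 1`
(`bref_eq_bondRefl`), generators `X κ u := diagK (−ctGen 3 α L κ u)`, `X₂ := diagK (ctGen·ctGen′)` (`comp_idF_diagK_comm`), the total laws R10, block covariance at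
blocking `1` (`blockCovariant_one` with `PkerSwap_translate`, `sliceA_translate`, `sliceW_translate`). -/
theorem axisReflectionCovariant_flip_hessKer_sliceTotal_straight
    (hS₃L : ∀ κ u, Loc (S₃ κ u)) (hS₄L : ∀ κ u κ' u', Loc (S₄ κ u κ' u'))
    (hS₃t : ∀ (κ : Fin 4) (u t : Site 4), S₃ κ (u + t) = shiftK (-t) (S₃ κ u))
    (hS₄t : ∀ (κ : Fin 4) (u : Site 4) (κ' : Fin 4) (u' t : Site 4), S₄ κ (u + t) κ' (u' + t) = shiftK (-t) (S₄ κ u κ' u'))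
    (hS₃ : ∀ (α κ : Fin 4) (u : Site 4), S₃ κ (bref α κ u) = reflSign α κ • refK (Φ N α)
      (S₃ κ u + conjV ((fun x z a b => MF z x a b) - ddKer) (diagK (fun y c => -ctGen 3 α L κ u y c))))
    (hS₄ : ∀ (α κ : Fin 4) (u : Site 4) (κ' : Fin 4) (u' : Site 4), S₄ κ (bref α κ u) κ' (bref α κ' u') = (reflSign α κ * reflSign α κ') • refK (Φ N α)
      (S₄ κ u κ' u' + conjW ((fun x z a b => MF z x a b) - ddKer) (S₃ κ u) (S₃ κ' u') (diagK (fun y c => -ctGen 3 α L κ u y c))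
        (diagK (fun y c => -ctGen 3 α L κ' u' y c)) (diagK (fun y c => ctGen 3 α L κ u y c * ctGen 3 α L κ' u' y c)) + Rm α κ u κ' u'))
    (hRmL : ∀ α κ u κ' u', Loc (Rm α κ u κ' u')) (hRm0 : ∀ α κ u κ' u', tadpole (fun x z a b => Pker z x a b) (Rm α κ u κ' u') = 0) :
    AxisReflectionCovariant (fun μ ν z =>
      hessKer (fun x z a b => Pker z x a b) (fun κ u => S₃ κ u + sliceA 3 κ u) (fun κ u κ' u' => S₄ κ u κ' u' + sliceW 3 κ u κ' u') μ ν (-z)) := by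
  -- localisation of the total data
  have hV : ∀ κ u, Loc ((fun κ u => S₃ κ u + sliceA 3 κ u) κ u) := fun κ u =>
    (hS₃L κ u).add ⟨u, u, 2 * Real.exp (4 * 1), 1, one_pos, locStencil_sliceA (d := 3) zero_le_one κ u⟩
  have hW : ∀ κ u κ' u', Loc ((fun κ u κ' u' => S₄ κ u κ' u' + sliceW 3 κ u κ' u') κ u κ' u') := fun κ u κ' u' =>
    (hS₄L κ u κ' u').add ⟨u, u, _, 1, one_pos, biLoc_sliceW (d := 3) zero_le_one κ u κ' u'⟩
  -- block covariance at blocking `1`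
  have hcov : BlockCovariant (fun x z a b => Pker z x a b) (fun κ u => S₃ κ u + sliceA 3 κ u) (fun κ u κ' u' => S₄ κ u κ' u' + sliceW 3 κ u κ' u') 1 := by
    refine blockCovariant_one PkerSwap_translate (fun κ u t => ?_) (fun κ u κ' u' t => ?_)
    · show S₃ κ (u + t) + sliceA 3 κ (u + t) = shiftK (-t) (S₃ κ u + sliceA 3 κ u)
      rw [hS₃t, sliceA_translate]; rfl
    · show S₄ κ (u + t) κ' (u' + t) + sliceW 3 κ (u + t) κ' (u' + t) = shiftK (-t) (S₄ κ u κ' u' + sliceW 3 κ u κ' u')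
      rw [hS₄t, sliceW_translate]; rfl
  refine axisReflectionCovariant_flip_hessKer_chart_bdd bdd_PkerSwap spr_MFSwap spr_idF comp_PkerSwap_MFSwap comp_MFSwap_PkerSwap comp_PkerSwap_idF
    comp_idF_PkerSwap hV hW hcov fun α => ⟨Φ N α, refK_Φ_PkerSwap N α, 1, fun κ u => diagK (fun y c => -ctGen 3 α L κ u y c),
      fun κ u κ' u' => diagK (fun y c => ctGen 3 α L κ u y c * ctGen 3 α L κ' u' y c), Rm α,
      fun κ u => loc_diagK_neg_ctGen α L κ u, fun κ u κ' u' => loc_diagK_ctGen_mul α L κ u κ' u',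
      fun κ u => comp_idF_diagK_comm _, hRmL α, hRm0 α, fun κ u => ?_, fun κ u κ' u' => ?_⟩
  · rw [← bref_eq_bondRefl]
    exact srConj_total N L hS₃ α κ u
  · rw [← bref_eq_bondRefl, ← bref_eq_bondRefl]
    exact wrConj_total N L hS₄ α κ u κ' u'

end Instance

end Summit.QuantumFields.BalabanUV.Beta.FP.SliceKcovStraight

end
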